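import Literature.ModelTheory.ExponentialFields.Languages
import Mathlib.Algebra.Field.MinimalAxioms
import Mathlib.Algebra.Order.Ring.Defs
import Mathlib.Algebra.Order.Field.Basic
import Mathlib.Analysis.SpecialFunctions.Log.Basic
import HarnessLib

/-!
# Models of `T_exp = Th(ℝ_exp)` are ordered exponential fields

Trunk `TranscendEllArithS`, family `periods` (periods.S28), in support of the decomposition of
the named fact `Literature.ModelTheory.ExponentialFields.wilkie_isModelComplete` (`RealExpField.lean`; Wilkie, J. Amer. Math. Soc. 9
(1996), Second Main Theorem).  Wilkie's proof (and already the statement of its core, Wilkie,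
*Model theory of analytic and smooth functions*, in: Models and Computability, LMS Lecture Note
Ser. 259 (1999), p. 414: "if `k`, `K` are models of `Th(⟨ℝ̄, exp⟩)` with `k ⊆ K` and
`p(x₁,…,xₙ,y₁,…,yₙ)` is a polynomial with coefficients in `k` …") treats models of `T_exp` as
what they are algebraically: ordered fields (indeed real closed fields) equipped with an
exponential.  A model of `realExpTheory` in the tree is only an abstract
`Language.orderedExpRing`-structure `K : realExpTheory.ModelType`; this file equips (the carrier
of) every such bundled model with

* the operations `+`, `*`, `-`, `0`, `1`, the relation `≤` and the map `RealExpModel.exp`, read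
  off from the interpretation of the symbols, with the `funMap`/`RelMap`/`Term.realize`
  simp-lemmas (`RealExpModel.funMap_add`, …, `RealExpModel.realize_add`, …);
* the **transfer principle** `RealExpModel.realize_sentence_iff_real`: a sentence holds in `K`
  iff it holds in `ℝ` (because `realExpTheory = Th(ℝ_exp)` is complete);
* by transfer of finitely many sentences: instances `Field K`, `LinearOrder K`,
  `IsStrictOrderedRing K`, the facts that nonnegative elements are squares
  (`RealExpModel.exists_mul_self_eq`), and that `exp` is a homomorphism `(K,+) → (K_{>0},·)`
  (`RealExpModel.exp_zero`, `exp_add`, `exp_pos`);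
* compatibility instances: `K` is an ordered `Language.orderedExpRing`-structure
  (`Language.OrderedStructure`), its `Language.orderedRing`-structure coming from the notation
  classes is the reduct along `orderedRingHomOrderedExpRing` (`LHom.IsExpansionOn`), and
  embeddings `f : k ↪[Language.orderedExpRing] K` of models are ordered ring embeddings commuting
  with `exp` (`RealExpModel.map_add`, …, `map_exp`, `map_le_iff`).

Everything here is proved (no named facts).

## Mathlib search

Mathlib has the analogous construction for the language of rings only:
`FirstOrder.Field.fieldOfModelField` (a model of `Theory.field` is a field, via
`Field.ofMinimalAxioms`) and `FirstOrder.Language.linearOrderOfModels` (a model of the theory of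
linear orders is a linear order), both of which we reuse in spirit (`Field.ofMinimalAxioms`,
`linearOrderOfModels`); there is no exponential field and no `Th(ℝ_exp)` in Mathlib.

## Design choices

* All instances are on the carrier `↥K` of a *bundled* model `K : realExpTheory.ModelType`
  (never on a bare type carrying a structure instance), so they cannot collide with the
  instances of `ℝ`; `K` is **not** made an `Literature.ModelTheory.ExponentialFields.ExponentialRing` (that would create a second,
  non-definitional `Language.orderedExpRing`-structure on `K` via
  `Language.orderedExpRing.instStructure`).
* Universe: `K : Theory.ModelType.{0, 0, w} realExpTheory` for arbitrary `w`
  (`Theory.IsModelComplete` uses `w = 0`).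

## References

* A. J. Wilkie, *Model completeness results for expansions of the ordered field of real numbers
  by restricted Pfaffian functions and the exponential function*, J. Amer. Math. Soc. 9 (1996),
  1051–1094.
* A. J. Wilkie, *Model theory of analytic and smooth functions*, in: Models and Computability,
  LMS Lecture Note Ser. 259 (1999), 407–419, p. 414.
* D. Marker, *Model Theory: An Introduction*, GTM 217 (2002), §1.2, §2.2 (elementary
  equivalence; complete theories of structures).
-/

noncomputable section

open FirstOrder FirstOrder.Language FirstOrder.Language.Structure

universe w

namespace Literature.ModelTheory.ExponentialFields

namespace RealExpModel

variable (K : Language.Theory.ModelType.{0, 0, w} realExpTheory)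

/-! ### Transfer from `ℝ` -/

/-- **Transfer principle** (one direction): every sentence of the language of ordered
exponential rings true in `ℝ_exp` is true in every model of `T_exp = Th(ℝ_exp)`
(Marker 2002, §2.2: models of the complete theory of a structure). [folklore] -/
theorem realize_sentence_of_real {σ : Language.orderedExpRing.Sentence} (h : ℝ ⊨ σ) : K ⊨ σ :=
  Language.Theory.realize_sentence_of_mem realExpTheory
    (show σ ∈ realExpTheory from Language.mem_completeTheory.2 h)

/-- **Transfer principle**: a sentence holds in a model of `T_exp` iff it holds in `ℝ_exp`
(`T_exp` is the complete theory of `ℝ_exp`; Marker 2002, §2.2). [folklore] -/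
theorem realize_sentence_iff_real (σ : Language.orderedExpRing.Sentence) : K ⊨ σ ↔ ℝ ⊨ σ := by
  refine ⟨fun h => ?_, realize_sentence_of_real K⟩
  by_contra hR
  have h' : ℝ ⊨ σ.not := hR
  exact (realize_sentence_of_real K h') h

/-- Transfer of theories: every `Language.orderedExpRing`-theory with model `ℝ_exp` holds in every
model of `T_exp`. [folklore] -/
theorem model_of_real (T : Language.orderedExpRing.Theory) [h : ℝ ⊨ T] : K ⊨ T :=
  ⟨fun σ hσ => realize_sentence_of_real K (h.realize_of_mem σ hσ)⟩

/-! ### The operations of a model -/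

variable {K}

/-- Addition of a model of `T_exp`: the interpretation of the symbol `+`. [folklore] -/
instance : Add K :=
  ⟨fun a b => funMap (L := Language.orderedExpRing) expRingFunc.add ![a, b]⟩

/-- Multiplication of a model of `T_exp`: the interpretation of the symbol `*`. [folklore] -/
instance : Mul K :=
  ⟨fun a b => funMap (L := Language.orderedExpRing) expRingFunc.mul ![a, b]⟩

/-- Negation of a model of `T_exp`: the interpretation of the symbol `-`. [folklore] -/
instance : Neg K :=
  ⟨fun a => funMap (L := Language.orderedExpRing) expRingFunc.neg ![a]⟩

/-- Zero of a model of `T_exp`: the interpretation of the constant symbol `0`. [folklore] -/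
instance : Zero K :=
  ⟨funMap (L := Language.orderedExpRing) (expRingFunc.zero : Language.orderedExpRing.Functions 0)
    default⟩

/-- One of a model of `T_exp`: the interpretation of the constant symbol `1`. [folklore] -/
instance : One K :=
  ⟨funMap (L := Language.orderedExpRing) (expRingFunc.one : Language.orderedExpRing.Functions 0)
    default⟩

/-- The exponential of a model of `T_exp`: the interpretation of the symbol `exp`. [folklore] -/
def exp (a : K) : K :=
  funMap (L := Language.orderedExpRing) expRingFunc.exp ![a]

/-- `a + b` is the interpretation of `+` (by definition). [folklore] -/
theorem add_def (a b : K) :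
    a + b = funMap (L := Language.orderedExpRing) expRingFunc.add ![a, b] := rfl

/-- `a * b` is the interpretation of `*` (by definition). [folklore] -/
theorem mul_def (a b : K) :
    a * b = funMap (L := Language.orderedExpRing) expRingFunc.mul ![a, b] := rfl

/-- `-a` is the interpretation of `-` (by definition). [folklore] -/
theorem neg_def (a : K) : -a = funMap (L := Language.orderedExpRing) expRingFunc.neg ![a] := rfl

/-- `0` is the interpretation of the constant symbol `0` (by definition). [folklore] -/
theorem zero_def : (0 : K) =
    funMap (L := Language.orderedExpRing) (expRingFunc.zero : Language.orderedExpRing.Functions 0)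
      default := rfl

/-- `1` is the interpretation of the constant symbol `1` (by definition). [folklore] -/
theorem one_def : (1 : K) =
    funMap (L := Language.orderedExpRing) (expRingFunc.one : Language.orderedExpRing.Functions 0)
      default := rfl

/-- `exp a` is the interpretation of `exp` (by definition). [folklore] -/
theorem exp_def (a : K) :
    exp a = funMap (L := Language.orderedExpRing) expRingFunc.exp ![a] := rfl

/-- Interpretation of `+` in a model. [folklore] -/
@[simp] theorem funMap_add (v : Fin 2 → K) :
    funMap (L := Language.orderedExpRing) expRingFunc.add v = v 0 + v 1 := by
  rw [add_def]; exact congrArg _ (by ext i; fin_cases i <;> rfl)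

/-- Interpretation of `*` in a model. [folklore] -/
@[simp] theorem funMap_mul (v : Fin 2 → K) :
    funMap (L := Language.orderedExpRing) expRingFunc.mul v = v 0 * v 1 := by
  rw [mul_def]; exact congrArg _ (by ext i; fin_cases i <;> rfl)

/-- Interpretation of `-` in a model. [folklore] -/
@[simp] theorem funMap_neg (v : Fin 1 → K) :
    funMap (L := Language.orderedExpRing) expRingFunc.neg v = -v 0 := by
  rw [neg_def]; exact congrArg _ (by ext i; fin_cases i; rfl)

/-- Interpretation of `0` in a model. [folklore] -/
@[simp] theorem funMap_zero (v : Fin 0 → K) :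
    funMap (L := Language.orderedExpRing) expRingFunc.zero v = 0 := by
  rw [zero_def]; exact congrArg _ (Subsingleton.elim _ _)

/-- Interpretation of `1` in a model. [folklore] -/
@[simp] theorem funMap_one (v : Fin 0 → K) :
    funMap (L := Language.orderedExpRing) expRingFunc.one v = 1 := by
  rw [one_def]; exact congrArg _ (Subsingleton.elim _ _)

/-- Interpretation of `exp` in a model. [folklore] -/
@[simp] theorem funMap_exp (v : Fin 1 → K) :
    funMap (L := Language.orderedExpRing) expRingFunc.exp v = exp (v 0) := by
  rw [exp_def]; exact congrArg _ (by ext i; fin_cases i; rfl)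

/-- The constant symbol `0` names `0`. [folklore] -/
@[simp] theorem coe_zero :
    (constantMap (L := Language.orderedExpRing) expRingFunc.zero : K) = 0 := rfl

/-- The constant symbol `1` names `1`. [folklore] -/
@[simp] theorem coe_one :
    (constantMap (L := Language.orderedExpRing) expRingFunc.one : K) = 1 := rfl

section Terms

variable {α : Type*} (v : α → K)

/-- Realization of the term `0` in a model. [folklore] -/
@[simp] theorem realize_zero : (0 : Language.orderedExpRing.Term α).realize v = 0 := by
  show (Constants.term _).realize v = 0
  rw [Term.realize_constants]; rfl

/-- Realization of the term `1` in a model. [folklore] -/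
@[simp] theorem realize_one : (1 : Language.orderedExpRing.Term α).realize v = 1 := by
  show (Constants.term _).realize v = 1
  rw [Term.realize_constants]; rfl

/-- Realization of `t₁ + t₂` in a model. [folklore] -/
@[simp] theorem realize_add (t₁ t₂ : Language.orderedExpRing.Term α) :
    (t₁ + t₂).realize v = t₁.realize v + t₂.realize v := by
  show (Functions.apply₂ _ t₁ t₂).realize v = _
  rw [Term.realize_functions_apply₂, funMap_add]
  rfl

/-- Realization of `t₁ * t₂` in a model. [folklore] -/
@[simp] theorem realize_mul (t₁ t₂ : Language.orderedExpRing.Term α) :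
    (t₁ * t₂).realize v = t₁.realize v * t₂.realize v := by
  show (Functions.apply₂ _ t₁ t₂).realize v = _
  rw [Term.realize_functions_apply₂, funMap_mul]
  rfl

/-- Realization of `-t` in a model. [folklore] -/
@[simp] theorem realize_neg (t : Language.orderedExpRing.Term α) :
    (-t).realize v = -t.realize v := by
  show (Functions.apply₁ _ t).realize v = _
  rw [Term.realize_functions_apply₁, funMap_neg]
  rfl

/-- Realization of `exp t` in a model. [folklore] -/
@[simp] theorem realize_termExp (t : Language.orderedExpRing.Term α) :
    (Language.orderedExpRing.termExp t).realize v = exp (t.realize v) := by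
  show (Functions.apply₁ _ t).realize v = _
  rw [Term.realize_functions_apply₁, funMap_exp]
  rfl

end Terms

/-! ### The order -/

/-- A model of `T_exp` is linearly ordered by the interpretation of `≤` (transfer of the axioms
of linear orders from `ℝ`; Mathlib's `linearOrderOfModels`). [folklore] -/
instance : LinearOrder K :=
  letI : DecidableRel fun a b : K =>
      RelMap (Language.leSymb : Language.orderedExpRing.Relations 2) ![a, b] :=
    Classical.decRel _
  haveI : K ⊨ Language.orderedExpRing.linearOrderTheory := model_of_real K _
  Language.orderedExpRing.linearOrderOfModels K

/-- `a ≤ b` is the interpretation of the symbol `≤` (by definition). [folklore] -/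
theorem le_iff (a b : K) :
    a ≤ b ↔ RelMap (Language.leSymb : Language.orderedExpRing.Relations 2) ![a, b] :=
  Iff.rfl

/-- A model of `T_exp` is an ordered `Language.orderedExpRing`-structure in Mathlib's sense. [folklore] -/
instance : Language.orderedExpRing.OrderedStructure K where
  relMap_leSymb x := by
    have hx : ![x 0, x 1] = x := by ext i; fin_cases i <;> rfl
    rw [le_iff, hx]

/-- Interpretation of `≤` in a model. [folklore] -/
@[simp] theorem relMap_le (v : Fin 2 → K) :
    RelMap (L := Language.orderedExpRing) Language.orderRel.le v ↔ v 0 ≤ v 1 :=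
  Language.relMap_leSymb v

/-! ### The field structure -/

/-- Transfer of an axiom of ordered fields from `ℝ` (auxiliary; use the `Field`/`IsStrictOrderedRing`
instances). [folklore] -/
private theorem add_assoc' (a b c : K) : a + b + c = a + (b + c) := by
  have h := realize_sentence_of_real K
    (σ := ∀' ∀' ∀' (((&0 + &1) + &2) =' (&0 + (&1 + &2))))
    (by simp [Sentence.Realize, Formula.Realize, Fin.snoc, add_assoc])
  simp [Sentence.Realize, Formula.Realize, Fin.snoc] at h
  exact h a b c

/-- Transfer of an axiom of ordered fields from `ℝ` (auxiliary; use the `Field`/`IsStrictOrderedRing`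
instances). [folklore] -/
private theorem zero_add' (a : K) : 0 + a = a := by
  have h := realize_sentence_of_real K
    (σ := ∀' (((0 : Language.orderedExpRing.Term _) + &0) =' &0))
    (by simp [Sentence.Realize, Formula.Realize, Fin.snoc])
  simp [Sentence.Realize, Formula.Realize, Fin.snoc] at h
  exact h a

/-- Transfer of an axiom of ordered fields from `ℝ` (auxiliary; use the `Field`/`IsStrictOrderedRing`
instances). [folklore] -/
private theorem neg_add_cancel' (a : K) : -a + a = 0 := by
  have h := realize_sentence_of_real K
    (σ := ∀' ((-&0 + &0) =' 0))
    (by simp [Sentence.Realize, Formula.Realize, Fin.snoc])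
  simp [Sentence.Realize, Formula.Realize, Fin.snoc] at h
  exact h a

/-- Transfer of an axiom of ordered fields from `ℝ` (auxiliary; use the `Field`/`IsStrictOrderedRing`
instances). [folklore] -/
private theorem mul_assoc' (a b c : K) : a * b * c = a * (b * c) := by
  have h := realize_sentence_of_real K
    (σ := ∀' ∀' ∀' (((&0 * &1) * &2) =' (&0 * (&1 * &2))))
    (by simp [Sentence.Realize, Formula.Realize, Fin.snoc, mul_assoc])
  simp [Sentence.Realize, Formula.Realize, Fin.snoc] at h
  exact h a b c

/-- Transfer of an axiom of ordered fields from `ℝ` (auxiliary; use the `Field`/`IsStrictOrderedRing`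
instances). [folklore] -/
private theorem mul_comm' (a b : K) : a * b = b * a := by
  have h := realize_sentence_of_real K
    (σ := ∀' ∀' ((&0 * &1) =' (&1 * &0)))
    (by simp [Sentence.Realize, Formula.Realize, Fin.snoc, mul_comm])
  simp [Sentence.Realize, Formula.Realize, Fin.snoc] at h
  exact h a b

/-- Transfer of an axiom of ordered fields from `ℝ` (auxiliary; use the `Field`/`IsStrictOrderedRing`
instances). [folklore] -/
private theorem one_mul' (a : K) : 1 * a = a := by
  have h := realize_sentence_of_real K
    (σ := ∀' (((1 : Language.orderedExpRing.Term _) * &0) =' &0))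
    (by simp [Sentence.Realize, Formula.Realize, Fin.snoc])
  simp [Sentence.Realize, Formula.Realize, Fin.snoc] at h
  exact h a

/-- Transfer of an axiom of ordered fields from `ℝ` (auxiliary; use the `Field`/`IsStrictOrderedRing`
instances). [folklore] -/
private theorem exists_inv' (a : K) (ha : a ≠ 0) : ∃ b : K, a * b = 1 := by
  have h := realize_sentence_of_real K
    (σ := ∀' (∼(&0 =' 0) ⟹ ∃' ((&0 * &1) =' 1)))
    (by
      simp only [Sentence.Realize, Formula.Realize, BoundedFormula.realize_all,
        BoundedFormula.realize_imp, BoundedFormula.realize_not, BoundedFormula.realize_bdEqual,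
        BoundedFormula.realize_ex]
      intro x hx
      refine ⟨x⁻¹, ?_⟩
      simp [Fin.snoc] at hx ⊢
      exact mul_inv_cancel₀ hx)
  simp [Sentence.Realize, Formula.Realize, Fin.snoc] at h
  exact h a ha

/-- Transfer of an axiom of ordered fields from `ℝ` (auxiliary; use the `Field`/`IsStrictOrderedRing`
instances). [folklore] -/
private theorem left_distrib' (a b c : K) : a * (b + c) = a * b + a * c := by
  have h := realize_sentence_of_real K
    (σ := ∀' ∀' ∀' ((&0 * (&1 + &2)) =' ((&0 * &1) + (&0 * &2))))
    (by simp [Sentence.Realize, Formula.Realize, Fin.snoc, mul_add])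
  simp [Sentence.Realize, Formula.Realize, Fin.snoc] at h
  exact h a b c

/-- Transfer of an axiom of ordered fields from `ℝ` (auxiliary; use the `Field`/`IsStrictOrderedRing`
instances). [folklore] -/
private theorem zero_ne_one' : (0 : K) ≠ 1 := by
  have h := realize_sentence_of_real K
    (σ := ∼((0 : Language.orderedExpRing.Term _) =' 1))
    (by simp [Sentence.Realize, Formula.Realize])
  simpa [Sentence.Realize, Formula.Realize] using h

/-- A model of `T_exp` is a field (transfer of the field axioms from `ℝ`;
`Field.ofMinimalAxioms`). [folklore] -/
instance : Field K :=
  letI : Inv K := ⟨fun a => if ha : a = 0 then 0 else Classical.choose (exists_inv' a ha)⟩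
  Field.ofMinimalAxioms K add_assoc' zero_add' neg_add_cancel' mul_assoc' mul_comm' one_mul'
    (fun a ha => show a * (dite _ _ _) = 1 by
      rw [dif_neg ha]; exact Classical.choose_spec (exists_inv' a ha))
    (dif_pos rfl) left_distrib' ⟨0, 1, zero_ne_one'⟩

/-! ### The ordered field structure -/

/-- Transfer of an axiom of ordered fields from `ℝ` (auxiliary; use the `Field`/`IsStrictOrderedRing`
instances). [folklore] -/
private theorem add_le_add_left' (a b : K) (hab : a ≤ b) (c : K) : a + c ≤ b + c := by
  have h := realize_sentence_of_real K
    (σ := ∀' ∀' ∀' ((&0).le &1 ⟹ Language.Term.le (&0 + &2) (&1 + &2)))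
    (by
      simp only [Sentence.Realize, Formula.Realize, BoundedFormula.realize_all,
        BoundedFormula.realize_imp, Term.realize_le]
      intro x y z hxy
      simpa [Fin.snoc] using hxy)
  simp only [Sentence.Realize, Formula.Realize, BoundedFormula.realize_all,
    BoundedFormula.realize_imp, Term.realize_le] at h
  simpa [Fin.snoc] using h a b c (by simpa [Fin.snoc] using hab)

/-- Transfer of an axiom of ordered fields from `ℝ` (auxiliary; use the `Field`/`IsStrictOrderedRing`
instances). [folklore] -/
private theorem zero_le_one' : (0 : K) ≤ 1 := by
  have h := realize_sentence_of_real K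
    (σ := (0 : Language.orderedExpRing.Term _).le 1)
    (by simp [Sentence.Realize, Formula.Realize])
  simpa [Sentence.Realize, Formula.Realize] using h

/-- Transfer of an axiom of ordered fields from `ℝ` (auxiliary; use the `Field`/`IsStrictOrderedRing`
instances). [folklore] -/
private theorem mul_pos' (a b : K) (ha : 0 < a) (hb : 0 < b) : 0 < a * b := by
  have h := realize_sentence_of_real K
    (σ := ∀' ∀' ((Language.Term.lt 0 &0) ⟹ ((Language.Term.lt 0 &1) ⟹ Language.Term.lt 0 (&0 * &1))))
    (by
      simp only [Sentence.Realize, Formula.Realize, BoundedFormula.realize_all,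
        BoundedFormula.realize_imp, Term.realize_lt]
      intro x y hx hy
      simp [Fin.snoc] at hx hy ⊢
      exact mul_pos hx hy)
  simp only [Sentence.Realize, Formula.Realize, BoundedFormula.realize_all,
    BoundedFormula.realize_imp, Term.realize_lt] at h
  simpa [Fin.snoc] using h a b (by simpa [Fin.snoc] using ha) (by simpa [Fin.snoc] using hb)

/-- Addition in a model of `T_exp` is monotone (transfer from `ℝ`). [folklore] -/
instance : IsOrderedAddMonoid K where
  add_le_add_left a b hab c := add_le_add_left' a b hab c

/-- A model of `T_exp` is a (strictly) ordered field (transfer from `ℝ`). [folklore] -/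
instance : IsStrictOrderedRing K :=
  haveI : ZeroLEOneClass K := ⟨zero_le_one'⟩
  IsStrictOrderedRing.of_mul_pos mul_pos'

/-- In a model of `T_exp` every nonnegative element is a square (transfer from `ℝ`). [folklore] -/
theorem exists_mul_self_eq {a : K} (ha : 0 ≤ a) : ∃ b : K, b * b = a := by
  have h := realize_sentence_of_real K
    (σ := ∀' ((0 : Language.orderedExpRing.Term _).le &0 ⟹ ∃' ((&1 * &1) =' &0)))
    (by
      simp only [Sentence.Realize, Formula.Realize, BoundedFormula.realize_all,
        BoundedFormula.realize_imp, Term.realize_le, BoundedFormula.realize_ex,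
        BoundedFormula.realize_bdEqual]
      intro x hx
      refine ⟨Real.sqrt x, ?_⟩
      simp [Fin.snoc] at hx ⊢
      exact Real.mul_self_sqrt hx)
  simp only [Sentence.Realize, Formula.Realize, BoundedFormula.realize_all,
    BoundedFormula.realize_imp, Term.realize_le, BoundedFormula.realize_ex,
    BoundedFormula.realize_bdEqual] at h
  obtain ⟨b, hb⟩ := h a (by simpa [Fin.snoc] using ha)
  exact ⟨b, by simpa [Fin.snoc] using hb⟩

/-- In a model of `T_exp`, `a ≤ b` iff `b - a` is a square. [folklore] -/
theorem le_iff_exists_mul_self (a b : K) : a ≤ b ↔ ∃ c : K, b - a = c * c := by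
  constructor
  · intro h
    obtain ⟨c, hc⟩ := exists_mul_self_eq (sub_nonneg.2 h)
    exact ⟨c, hc.symm⟩
  · rintro ⟨c, hc⟩
    exact sub_nonneg.1 (hc ▸ mul_self_nonneg c)

/-- In a model of `T_exp`, `a < b` iff `(b - a) c² = 1` for some `c`. [folklore] -/
theorem lt_iff_exists_mul_self (a b : K) : a < b ↔ ∃ c : K, (b - a) * (c * c) = 1 := by
  constructor
  · intro h
    have hba : 0 < b - a := sub_pos.2 h
    obtain ⟨c, hc⟩ := exists_mul_self_eq (inv_nonneg.2 hba.le)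
    exact ⟨c, by rw [hc, mul_inv_cancel₀ hba.ne']⟩
  · rintro ⟨c, hc⟩
    have h1 : 0 < (b - a) * (c * c) := by rw [hc]; exact one_pos
    rcases pos_and_pos_or_neg_and_neg_of_mul_pos h1 with ⟨h2, -⟩ | ⟨-, h2⟩
    · exact sub_pos.1 h2
    · exact absurd h2 (not_lt.2 (mul_self_nonneg c))

/-! ### The exponential -/

/-- `exp 0 = 1` in every model of `T_exp` (transfer). [folklore] -/
@[simp] theorem exp_zero : exp (0 : K) = 1 := by
  have h := realize_sentence_of_real K
    (σ := (Language.orderedExpRing.termExp 0) =' 1)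
    (by simp [Sentence.Realize, Formula.Realize])
  simpa [Sentence.Realize, Formula.Realize] using h

/-- `exp (a + b) = exp a * exp b` in every model of `T_exp` (transfer). [folklore] -/
theorem exp_add (a b : K) : exp (a + b) = exp a * exp b := by
  have h := realize_sentence_of_real K
    (σ := ∀' ∀' ((Language.orderedExpRing.termExp (&0 + &1)) ='
      (Language.orderedExpRing.termExp &0 * Language.orderedExpRing.termExp &1)))
    (by simp [Sentence.Realize, Formula.Realize, Fin.snoc, Real.exp_add])
  simp [Sentence.Realize, Formula.Realize, Fin.snoc] at h
  exact h a b

/-- `0 < exp a` in every model of `T_exp` (transfer). [folklore] -/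
theorem exp_pos (a : K) : 0 < exp a := by
  have h := realize_sentence_of_real K
    (σ := ∀' (Language.Term.lt 0 (Language.orderedExpRing.termExp &0)))
    (by
      simp only [Sentence.Realize, Formula.Realize, BoundedFormula.realize_all, Term.realize_lt]
      intro x
      simpa [Fin.snoc] using Real.exp_pos x)
  simp only [Sentence.Realize, Formula.Realize, BoundedFormula.realize_all, Term.realize_lt] at h
  simpa [Fin.snoc] using h a

/-- `exp` is strictly monotone in every model of `T_exp` (transfer). [folklore] -/
theorem exp_lt_exp {a b : K} (hab : a < b) : exp a < exp b := by
  have h := realize_sentence_of_real K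
    (σ := ∀' ∀' (Language.Term.lt &0 &1 ⟹
      Language.Term.lt (Language.orderedExpRing.termExp &0) (Language.orderedExpRing.termExp &1)))
    (by
      simp only [Sentence.Realize, Formula.Realize, BoundedFormula.realize_all,
        BoundedFormula.realize_imp, Term.realize_lt]
      intro x y hxy
      simpa [Fin.snoc] using hxy)
  simp only [Sentence.Realize, Formula.Realize, BoundedFormula.realize_all,
    BoundedFormula.realize_imp, Term.realize_lt] at h
  simpa [Fin.snoc] using h a b (by simpa [Fin.snoc] using hab)

/-- Every positive element of a model of `T_exp` is an exponential (transfer of the surjectivity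
of `Real.exp` onto the positive reals). [folklore] -/
theorem exists_exp_eq {a : K} (ha : 0 < a) : ∃ b : K, exp b = a := by
  have h := realize_sentence_of_real K
    (σ := ∀' (Language.Term.lt 0 &0 ⟹ ∃' ((Language.orderedExpRing.termExp &1) =' &0)))
    (by
      simp only [Sentence.Realize, Formula.Realize, BoundedFormula.realize_all,
        BoundedFormula.realize_imp, Term.realize_lt, BoundedFormula.realize_ex,
        BoundedFormula.realize_bdEqual]
      intro x hx
      refine ⟨Real.log x, ?_⟩
      simp [Fin.snoc] at hx ⊢
      exact Real.exp_log hx)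
  simp only [Sentence.Realize, Formula.Realize, BoundedFormula.realize_all,
    BoundedFormula.realize_imp, Term.realize_lt, BoundedFormula.realize_ex,
    BoundedFormula.realize_bdEqual] at h
  obtain ⟨b, hb⟩ := h a (by simpa [Fin.snoc] using ha)
  exact ⟨b, by simpa [Fin.snoc] using hb⟩

/-! ### Reducts and embeddings -/

/-- The `Language.orderedRing`-structure of a model given by its operations and order (the
Presburger-pattern instance `Language.orderedRing.instStructure`) is the reduct of its
`Language.orderedExpRing`-structure along `orderedRingHomOrderedExpRing`. [folklore] -/
instance : orderedRingHomOrderedExpRing.IsExpansionOn K where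
  map_onFunction f v := by
    cases f
    · exact funMap_add v
    · exact funMap_mul v
    · exact funMap_neg v
    · exact funMap_zero v
    · exact funMap_one v
  map_onRelation r v := by cases r; exact propext (relMap_le v)

/-- Realization in a model of a term of the language of ordered rings, transported to the
language of ordered exponential rings, is its realization in the ordered-ring reduct. [folklore] -/
@[simp] theorem realize_onTerm {α : Type*} (p : Language.orderedRing.Term α) (v : α → K) :
    (orderedRingHomOrderedExpRing.onTerm p).realize v = p.realize v :=
  Language.LHom.realize_onTerm _ p v

section Embedding

variable {k : Language.Theory.ModelType.{0, 0, w} realExpTheory}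
  (f : k ↪[Language.orderedExpRing] K)

/-- Embeddings of models preserve `+`. [folklore] -/
@[simp] theorem map_add (a b : k) : f (a + b) = f a + f b := by
  rw [add_def, f.map_fun, add_def]; exact congrArg _ (by ext i; fin_cases i <;> rfl)

/-- Embeddings of models preserve `*`. [folklore] -/
@[simp] theorem map_mul (a b : k) : f (a * b) = f a * f b := by
  rw [mul_def, f.map_fun, mul_def]; exact congrArg _ (by ext i; fin_cases i <;> rfl)

/-- Embeddings of models preserve `-`. [folklore] -/
@[simp] theorem map_neg (a : k) : f (-a) = -f a := by
  rw [neg_def, f.map_fun, neg_def]; exact congrArg _ (by ext i; fin_cases i; rfl)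

/-- Embeddings of models preserve `0`. [folklore] -/
@[simp] theorem map_zero : f 0 = 0 := by
  rw [zero_def, f.map_fun, zero_def]; exact congrArg _ (Subsingleton.elim _ _)

/-- Embeddings of models preserve `1`. [folklore] -/
@[simp] theorem map_one : f 1 = 1 := by
  rw [one_def, f.map_fun, one_def]; exact congrArg _ (Subsingleton.elim _ _)

/-- Embeddings of models commute with `exp`. [folklore] -/
@[simp] theorem map_exp (a : k) : f (exp a) = exp (f a) := by
  rw [exp_def, f.map_fun, exp_def]; exact congrArg _ (by ext i; fin_cases i; rfl)

/-- Embeddings of models preserve and reflect `≤`. [folklore] -/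
@[simp] theorem map_le_iff (a b : k) : f a ≤ f b ↔ a ≤ b := by
  rw [le_iff, le_iff]
  have h := f.map_rel (Language.leSymb : Language.orderedExpRing.Relations 2) ![a, b]
  have e : (f ∘ ![a, b]) = ![f a, f b] := by ext i; fin_cases i <;> rfl
  rw [e] at h
  exact h

/-- Embeddings of models preserve and reflect `<`. [folklore] -/
@[simp] theorem map_lt_iff (a b : k) : f a < f b ↔ a < b := by
  simp only [lt_iff_le_not_ge, map_le_iff]

/-- An embedding of models of `T_exp` as a ring homomorphism. [folklore] -/
def toRingHom : k →+* K where
  toFun := f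
  map_one' := map_one f
  map_mul' := map_mul f
  map_zero' := map_zero f
  map_add' := map_add f

/-- `toRingHom f` is `f` as a map. [folklore] -/
@[simp] theorem coe_toRingHom : ⇑(toRingHom f) = f := rfl

end Embedding

end RealExpModel

end Literature.ModelTheory.ExponentialFields
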